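import Summits.ResolutionOfSingularities.ResolutionOfSingularities.Theorems.WeightedInvariantHypersurfaceLocalGameEFT4S

/-!
# `HypersurfaceCentreConstruction` — negative lemma: a MOVE-CLOSED FAMILY of singular e.f.t. positions kills the canonical game

Door crux `stmt-ResolutionOfSingularities-19897`
(`Summit.ResolutionOfSingularities.ResolutionOfSingularities.Theorems.HypersurfaceCentreConstruction`, route
`ResolutionOfSingularities/WeightedInvariant`, line `local-engine` v3.1, key stub `stub_localWeightedDropEFT4S` over the tree modules
`…HypersurfaceLocalGameEFT3` (p501595) / `…EFT4S` (p504475)); support item `stmt-ResolutionOfSingularities-0571` (`WeightedConstruction`).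
Refuter res-L1-w43-tri-1 (TRIAGER 1, lens «kangaroo discharge»), 2026-08-27; companion of
`…/Negative/CanonicalGameFalseOfForcedDescentChain.lean` (the LINEAR case); no definitions, proofs only.

[OURS · L1 W4.3 · AI-produced negative knowledge, weaker than expert review; nothing here asserts anything about Hironaka's problem.]

The honest shape of a counter-strategy to the canonical e.f.t. game is a TREE, not a line: a family `F` of positions `(S, f)`
(`S` an essentially-of-finite-type regular local algebra over one perfect field `k₀` of characteristic `p`, `0 ≠ f ∈ 𝔪²`) such that at
every member EVERY presented admissible move (a prime `P ∋ f` with the data (pres) of `CanonicalGameClause`: a system `u` spanning `𝔪`,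
weights `w` not all zero whose positively weighted members span `P`) has a successor prime `𝔫` of `B = cobordantAlgebra' u w`
(`t⁻¹ ∈ 𝔫 ⊇ P·B`, off the vertex, a `t⁻¹`-saturated factor `g` of `f` singular at `𝔫`) whose position `(B_𝔫, g)` is ring-isomorphic to an
essentially smooth local pull-back `(S', f₁ ⊗ 1)` of SOME member `(S₁, f₁)` of `F` — different moves may lead to different members.  This is
the e.f.t.-typed analogue of `SurvivingFamily` (`Theorems/WeightedConstruction/Negative/WeightedConstructionFalseOfSurvivingFamily`), and the
target type of a DESCENT CENSUS (tri-1 TRIAGE v5 §15.4–§15.7: the monomial-coefficient families `z⁴ + M₁x²y⁴ + M₂y⁵ (+ M₃y)` in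
characteristic 2 are the current candidates; none is verified closed — every analysed member has an exit to a won position).

* `canonicalGameClause_false_of_closedFamily` — a non-empty move-closed family refutes `CanonicalGameClause p ι J` for every `(ι, J)`
  with (c6) `IotaIsoInvariant ι` and (c11) `IotaJEssSmoothCompatible ι J`.  Proof without sequences: take a member of LEAST `ι`-value
  (`WellFounded.min` on `Ordinal`); (c9′) hands a move there with the drop at all its singular successors off the vertex over the centre;
  closure hands such a successor carrying, by (c6) + (c11), the `ι`-value of another member — smaller than the minimum.
* `localWeightedDropEFT3_false_of_closedFamily`, `localWeightedDropEFT4S_false_of_closedFamily` — the keyed candidates, by projection.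
  The linear case (all moves at the `i`-th member lead to the `(i+1)`-st) is `canonicalGameClause_false_of_forcedDescentChain`; the
  one-member case is res-L1-w43-idea-2's reproduction lemma (Sketch-R4).
-/

noncomputable section

open IsLocalRing AlgebraicGeometry CategoryTheory Literature.AlgebraicGeometry.Resolution
open Summit.ResolutionOfSingularities.ResolutionOfSingularities.Cruxes.HypersurfaceCentreConstruction.LocalEngine

set_option linter.dupNamespace false

namespace Summit.ResolutionOfSingularities.ResolutionOfSingularities.Theorems.HypersurfaceCentreConstruction.Negative

/-- **A non-empty move-closed family of singular e.f.t. positions kills the canonical game clause** for every `(ι, J)` with (c6) and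
(c11).  `F S f` is the membership predicate (on the ring and the equation; the e.f.t. / regularity instances are supplied at each use);
`hclosed` says members are singular (`0 ≠ f ∈ 𝔪²`) and every presented admissible move at a member has a singular successor off the vertex
over the centre whose position is, up to a ring isomorphism, an essentially smooth local pull-back of a member.  Proof: a member of least
`ι`-value receives from (c9′) a move all of whose singular successors have smaller `ι`, and from `hclosed` such a successor carrying the
`ι`-value of a member ((c6) + (c11)) — contradiction with minimality (`WellFounded.not_lt_min`). [folklore] -/
theorem canonicalGameClause_false_of_closedFamily (p : ℕ) (ι : (R : Type) → [CommRing R] → R → Ordinal.{0})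
    (J : (R : Type) → [CommRing R] → R → ℕ → Ideal R)
    (h6 : IotaIsoInvariant ι) (h11 : IotaJEssSmoothCompatible ι J)
    (k₀ : Type) [Field k₀] [CharP k₀ p] [PerfectField k₀]
    (F : (S : Type) → [CommRing S] → [Algebra k₀ S] → S → Prop)
    (hne : ∃ (S : Type) (_ : CommRing S) (_ : Algebra k₀ S) (_ : Algebra.EssFiniteType k₀ S) (_ : IsRegularLocalRing S)
      (f : S), F S f)
    (hclosed : ∀ (S : Type) [CommRing S] [Algebra k₀ S] [Algebra.EssFiniteType k₀ S] [IsRegularLocalRing S] (f : S), F S f →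
      f ≠ 0 ∧ f ∈ (maximalIdeal S) ^ 2 ∧
      ∀ (P : Ideal S) (n : ℕ) (u : Fin n → S) (w : Fin n → ℕ),
        P.IsPrime → f ∈ P → Ideal.span (Set.range u) = maximalIdeal S → (∃ j, 0 < w j) →
        Ideal.span {x | ∃ j, 0 < w j ∧ x = u j} = P →
        ∃ (𝔫 : Ideal (cobordantAlgebra' u w)) (_ : 𝔫.IsPrime),
          cobordantT' u w ∈ 𝔫 ∧ P.map (algebraMap S (cobordantAlgebra' u w)) ≤ 𝔫 ∧
          ¬ (extReesAlgebra.vertexIdeal (weightedMonomialIdeal u w) ≤ 𝔫) ∧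
          ∃ (a : ℕ) (g : cobordantAlgebra' u w),
            algebraMap S (cobordantAlgebra' u w) f = cobordantT' u w ^ a * g ∧ ¬ (cobordantT' u w ∣ g) ∧
            algebraMap (cobordantAlgebra' u w) (Localization.AtPrime 𝔫) g ∈ (maximalIdeal (Localization.AtPrime 𝔫)) ^ 2 ∧
            ∃ (S₁ : Type) (_ : CommRing S₁) (_ : Algebra k₀ S₁) (_ : Algebra.EssFiniteType k₀ S₁) (_ : IsRegularLocalRing S₁)
              (f₁ : S₁), F S₁ f₁ ∧
              ∃ (S' : Type) (_ : CommRing S') (_ : IsRegularLocalRing S') (_ : Algebra S₁ S')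
                (_ : IsLocalHom (algebraMap S₁ S')) (_ : Algebra.FormallySmooth S₁ S') (_ : Algebra.EssFiniteType S₁ S')
                (e : Localization.AtPrime 𝔫 ≃+* S'),
                e (algebraMap (cobordantAlgebra' u w) (Localization.AtPrime 𝔫) g) = algebraMap S₁ S' f₁) :
    ¬ CanonicalGameClause p ι J := by
  intro hgame
  set A : Set Ordinal.{0} := {α | ∃ (S : Type) (_ : CommRing S) (_ : Algebra k₀ S) (_ : Algebra.EssFiniteType k₀ S)
    (_ : IsRegularLocalRing S) (f : S), F S f ∧ ι S f = α} with hA_def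
  have wf : WellFounded ((· < ·) : Ordinal.{0} → Ordinal.{0} → Prop) := wellFounded_lt
  have hA : A.Nonempty := by
    obtain ⟨S, _, _, _, _, f, hF⟩ := hne
    exact ⟨ι S f, S, inferInstance, inferInstance, inferInstance, inferInstance, f, hF, rfl⟩
  obtain ⟨S, _, _, _, _, f, hF, hα⟩ := wf.min_mem A hA
  obtain ⟨hf0, hf2, hmoves⟩ := hclosed S f hF
  obtain ⟨P, hP, -, hfP, -, -, n, u, w, hspan, -, hpos, hcentre, -, -, hdrop⟩ := hgame k₀ S f hf0 hf2
  obtain ⟨𝔫, h𝔫, ht, hP𝔫, hv, a, g, hfg, hndvd, hg2, S₁, _, _, _, _, f₁, hF₁, S', _, _, _, _, _, _, e, he⟩ :=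
    hmoves P n u w hP hfP hspan hpos hcentre
  have h := hdrop 𝔫 ht hP𝔫 hv a g hfg hndvd hg2
  have h1 : ι S' (e (algebraMap (cobordantAlgebra' u w) (Localization.AtPrime 𝔫) g)) =
      ι (Localization.AtPrime 𝔫) (algebraMap (cobordantAlgebra' u w) (Localization.AtPrime 𝔫) g) :=
    h6 (Localization.AtPrime 𝔫) S' e (algebraMap (cobordantAlgebra' u w) (Localization.AtPrime 𝔫) g)
  have h2 : ι S' (algebraMap S₁ S' f₁) = ι S₁ f₁ := (h11 S₁ S' f₁).1
  rw [← h1, he, h2, hα] at h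
  have hmem : ι S₁ f₁ ∈ A := ⟨S₁, inferInstance, inferInstance, inferInstance, inferInstance, f₁, hF₁, rfl⟩
  exact wf.not_lt_min A hmem h

/-- Corollary: a non-empty move-closed family of singular e.f.t. positions in characteristic `p` refutes H2a‴ `LocalWeightedDropEFT3 p`.
[folklore] -/
theorem localWeightedDropEFT3_false_of_closedFamily (p : ℕ)
    (k₀ : Type) [Field k₀] [CharP k₀ p] [PerfectField k₀]
    (F : (S : Type) → [CommRing S] → [Algebra k₀ S] → S → Prop)
    (hne : ∃ (S : Type) (_ : CommRing S) (_ : Algebra k₀ S) (_ : Algebra.EssFiniteType k₀ S) (_ : IsRegularLocalRing S)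
      (f : S), F S f)
    (hclosed : ∀ (S : Type) [CommRing S] [Algebra k₀ S] [Algebra.EssFiniteType k₀ S] [IsRegularLocalRing S] (f : S), F S f →
      f ≠ 0 ∧ f ∈ (maximalIdeal S) ^ 2 ∧
      ∀ (P : Ideal S) (n : ℕ) (u : Fin n → S) (w : Fin n → ℕ),
        P.IsPrime → f ∈ P → Ideal.span (Set.range u) = maximalIdeal S → (∃ j, 0 < w j) →
        Ideal.span {x | ∃ j, 0 < w j ∧ x = u j} = P →
        ∃ (𝔫 : Ideal (cobordantAlgebra' u w)) (_ : 𝔫.IsPrime),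
          cobordantT' u w ∈ 𝔫 ∧ P.map (algebraMap S (cobordantAlgebra' u w)) ≤ 𝔫 ∧
          ¬ (extReesAlgebra.vertexIdeal (weightedMonomialIdeal u w) ≤ 𝔫) ∧
          ∃ (a : ℕ) (g : cobordantAlgebra' u w),
            algebraMap S (cobordantAlgebra' u w) f = cobordantT' u w ^ a * g ∧ ¬ (cobordantT' u w ∣ g) ∧
            algebraMap (cobordantAlgebra' u w) (Localization.AtPrime 𝔫) g ∈ (maximalIdeal (Localization.AtPrime 𝔫)) ^ 2 ∧
            ∃ (S₁ : Type) (_ : CommRing S₁) (_ : Algebra k₀ S₁) (_ : Algebra.EssFiniteType k₀ S₁) (_ : IsRegularLocalRing S₁)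
              (f₁ : S₁), F S₁ f₁ ∧
              ∃ (S' : Type) (_ : CommRing S') (_ : IsRegularLocalRing S') (_ : Algebra S₁ S')
                (_ : IsLocalHom (algebraMap S₁ S')) (_ : Algebra.FormallySmooth S₁ S') (_ : Algebra.EssFiniteType S₁ S')
                (e : Localization.AtPrime 𝔫 ≃+* S'),
                e (algebraMap (cobordantAlgebra' u w) (Localization.AtPrime 𝔫) g) = algebraMap S₁ S' f₁) :
    ¬ LocalWeightedDropEFT3 p := by
  rintro ⟨ι, J, h6, -, -, -, -, h11, hgame, -, -, -⟩
  exact canonicalGameClause_false_of_closedFamily p ι J h6 h11 k₀ F hne hclosed hgame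

/-- Corollary: a non-empty move-closed family of singular e.f.t. positions in characteristic `p` refutes the v3.1 key H2a⁗
`LocalWeightedDropEFT4S p`. [folklore] -/
theorem localWeightedDropEFT4S_false_of_closedFamily (p : ℕ)
    (k₀ : Type) [Field k₀] [CharP k₀ p] [PerfectField k₀]
    (F : (S : Type) → [CommRing S] → [Algebra k₀ S] → S → Prop)
    (hne : ∃ (S : Type) (_ : CommRing S) (_ : Algebra k₀ S) (_ : Algebra.EssFiniteType k₀ S) (_ : IsRegularLocalRing S)
      (f : S), F S f)
    (hclosed : ∀ (S : Type) [CommRing S] [Algebra k₀ S] [Algebra.EssFiniteType k₀ S] [IsRegularLocalRing S] (f : S), F S f →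
      f ≠ 0 ∧ f ∈ (maximalIdeal S) ^ 2 ∧
      ∀ (P : Ideal S) (n : ℕ) (u : Fin n → S) (w : Fin n → ℕ),
        P.IsPrime → f ∈ P → Ideal.span (Set.range u) = maximalIdeal S → (∃ j, 0 < w j) →
        Ideal.span {x | ∃ j, 0 < w j ∧ x = u j} = P →
        ∃ (𝔫 : Ideal (cobordantAlgebra' u w)) (_ : 𝔫.IsPrime),
          cobordantT' u w ∈ 𝔫 ∧ P.map (algebraMap S (cobordantAlgebra' u w)) ≤ 𝔫 ∧
          ¬ (extReesAlgebra.vertexIdeal (weightedMonomialIdeal u w) ≤ 𝔫) ∧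
          ∃ (a : ℕ) (g : cobordantAlgebra' u w),
            algebraMap S (cobordantAlgebra' u w) f = cobordantT' u w ^ a * g ∧ ¬ (cobordantT' u w ∣ g) ∧
            algebraMap (cobordantAlgebra' u w) (Localization.AtPrime 𝔫) g ∈ (maximalIdeal (Localization.AtPrime 𝔫)) ^ 2 ∧
            ∃ (S₁ : Type) (_ : CommRing S₁) (_ : Algebra k₀ S₁) (_ : Algebra.EssFiniteType k₀ S₁) (_ : IsRegularLocalRing S₁)
              (f₁ : S₁), F S₁ f₁ ∧
              ∃ (S' : Type) (_ : CommRing S') (_ : IsRegularLocalRing S') (_ : Algebra S₁ S')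
                (_ : IsLocalHom (algebraMap S₁ S')) (_ : Algebra.FormallySmooth S₁ S') (_ : Algebra.EssFiniteType S₁ S')
                (e : Localization.AtPrime 𝔫 ≃+* S'),
                e (algebraMap (cobordantAlgebra' u w) (Localization.AtPrime 𝔫) g) = algebraMap S₁ S' f₁) :
    ¬ LocalWeightedDropEFT4S p := by
  rintro ⟨ι, J, h6, -, -, -, -, h11, hgame, -, -, -⟩
  exact canonicalGameClause_false_of_closedFamily p ι J h6 h11 k₀ F hne hclosed hgame

end Summit.ResolutionOfSingularities.ResolutionOfSingularities.Theorems.HypersurfaceCentreConstruction.Negative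

end
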